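import Literature.IUT.HodgeTheaters.GenuineFKitOfBadLocal
import Literature.IUT.HodgeTheaters.GenuineFKitOfBadLocalRealified
import Mathlib.CategoryTheory.Sums.Basic
import HarnessLib

/-!
# The (m1) slot of the L5 merge record is INHABITED over EVERY group datum: a MODEL tempered side
# `TemperedThetaInput.sumModel d T hq` (disjoint-union carriers), `InitialThetaData.badTemperedSideModel`, and the knit
# `Nonempty (MergeInputs D B) ↔ (∀ bad x, Nonempty (BadLocalGroupDatum G_x ↥(B x).H)) ∧ GeomTFG`

S. Mochizuki, *Inter-universal Teichmüller theory I*, kurims manuscript (May 2020), Example 3.2 (i)–(v) pp. 69–73 («a tempered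
Frobenioid `ℱ̲_v` … over a base category `𝒟_v`», «`T_(−)` the Frobenius-trivial object … that lies over `(−)`», «the birationalization
`ℱ÷_v := ℱ̲_v^birat`», «`Θ̲_v ∈ 𝒪^×(T^÷_{Ÿ_v})`», «`l·ℤ ⊆ Aut(T_{Ÿ_v})`», «`𝒞_v ⊆ ℱ̲_v`», «`𝒞⊢_v (⊆ 𝒞_v ⊆ ℱ̲_v → ℱ÷_v)`», «`𝒞^Θ_v (⊆ ℱ÷_v)`»),
Definition 5.2 (i)–(iv) pp. 134–135 ([IUTchI] Ex 3.2 (i) p.70) [claim: Mochizuki2012, status: disputed] (D-0012 claim key, series status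
DISPUTED — a MODEL CONSTRUCTION over abc-iut-L5-t2's frozen interfaces `BadLocalGroupDatum` / `TemperedThetaInput` / `MergeInputs`; nothing
of the series is asserted; no side is taken on [IUTchIII] Cor. 3.12).

## What this file builds (cell abc-iut, seat abc-iut-L5-t3 gen 10; L5 ROWS #7 / RULINGS #119 (2) row R59 «MERGEINPUTS-NV», m1 HALF)

RULINGS #119 (2) fixed the flip condition of every «mod `I : MergeInputs`» Ex. 3.2 candidate as TOKEN STANDARD (b): `Nonempty (MergeInputs
D B)` or the per-slot inhabitation of (m1) · (m2) · (m4) at ONE explicit datum, MODEL allowed and LABELLED.  abc-iut-L5-t2 inhabited (m4)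
BY NAME (`realifiedGlobalSideOfModuli`, p497530) and takes (m2) at the `X̲→`-profinite stand-in; its `TemperedThetaInput.trivial` (p441995)
inhabits (m1) ONLY over the degenerate group datum `aug = id` («the Frobenius-trivial object `Tobj A` cannot be total over `𝒟_v` when `𝒞^Θ`
lives over `𝒟^Θ ⊊ 𝒟_v`», abc-iut-L5-t2 2026-08-27T04:57:11Z).  This file removes that restriction:

* §1 **`TemperedThetaInput.sumModel d T hq : TemperedThetaInput d T hq (SumCarrier d T hq) (SumCarrier d T hq) (d.Cdash hq)`** for EVERY
  `T : BadLocalGroupDatum d.Gal P` and every non-unit `q̲`.  Carriers: `ℱ̲_v = ℱ÷_v := 𝒟_v ⊕ (𝒞⊢_v ⊕ 𝒞^Θ_v)` (Mathlib's sum of categories),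
  structure functor `toBase := 𝟭 ⊕ (𝒞⊢_v → 𝒟⊢_v ⊆ 𝒟_v) ⊕ (𝒞^Θ_v → 𝒟^Θ_v ⊆ (𝒟_v)_{Ÿ_v} → 𝒟_v)`, `Tobj := inl` (TOTAL over `𝒟_v` — the
  obstruction is met by giving `𝒞^Θ_v` its OWN summand), `birat := 𝟭`, `hull`/`CThetaToBirat` = the summand inclusions (faithful),
  `CdashToC := 𝟭`, `Θ̲_v := 1`, `𝒪^×(T^÷_Ÿ) := ⊥`, `l·ℤ := ⊥`, constants `:= 1`; bookkeeping lemmas `sumModel_theta/_unitsTY/_lZ/_Tobj`.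
* §2 **`InitialThetaData.badTemperedSideModel B x hx T : D.BadTemperedSide B x hx T`** for EVERY bad-pair datum `B`, bad index `x` and
  group datum `T` on the pair's own `Π_{X̳̲_v̲}`; `nonempty_badTemperedSide`.
* §3 the knit **`MergeInputs.ofGroupData B m2 m4 hTFG : D.MergeInputs B`** and **`nonempty_mergeInputs_iff`**:
  `Nonempty (D.MergeInputs B) ↔ (∀ x hx, Nonempty (BadLocalGroupDatum (D.GalAt x _) ↥(B x hx).H)) ∧ D.geom.extF.GeomTFG` ((m4) BY NAME:
  abc-iut-L5-t2 `realifiedGlobalSideOfModuli`).  So after this file R59 = EXACTLY the (m2) inhabitant at one explicit `B` + FACT F-0240.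

LABEL (travels with every use): «[m1 MODEL: formal disjoint-union tempered side over ANY group datum; `Θ̲_v`, `l·ℤ`, `𝒪^×(T^÷_Ÿ)`, the constants
are TRIVIAL — it witnesses that the TYPE `TemperedThetaInput d T hq` / the (m1) slot is INHABITED, it is NOT the [EtTh] §5 tempered Frobenioid of
the Tate curve (the L2 producer's object) and carries NO Ex. 3.2 (i) token]».  BINDER CENSUS: §1 {`d`, `T`, `q̲`, `hq`}; §2 {`B`, `x`, `hx`, `T`};
§3 {`B`, `m2`, `m4`, `hTFG`} — nothing else; FACT unnamed 0 (F-0240 `GeomTFG` enters as the displayed field/hypothesis it already is in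
`MergeInputs`); LAW 0; 0 instance · 0 notation · no `Prop` fact · no restatement (abc-iut-L5-t2's decls imported BY NAME).  HONEST FRAMING: a
MODEL inhabitant witnesses OUR binders only; typed ≠ inhabited ≠ discharged; nothing here asserts abc proved or refuted.
-/

noncomputable section

namespace Literature.IUT.HodgeTheaters

open CategoryTheory Literature.AnabelianGeometry.SemiGraphs Literature.AlgebraicGeometry.Frobenioids
  Literature.AlgebraicGeometry.Frobenioids.PadicFrd

/-! ### §0. The summand inclusions of a sum of categories are faithful -/

section SumFaithful

universe v₁ v₂ u₁ u₂

variable (C : Type u₁) [Category.{v₁} C] (C' : Type u₂) [Category.{v₂} C']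

/-- The left inclusion `C ⥤ C ⊕ C'` is faithful (its action on morphisms is `ULift.up`). [cite: Mochizuki2012, I Ex 3.2 (iii) p.71] -/
theorem sum_inl_faithful : (Sum.inl_ C C').Faithful :=
  ⟨fun {_ _} _ _ h => congrArg ULift.down h⟩

/-- The right inclusion `C' ⥤ C ⊕ C'` is faithful. [cite: Mochizuki2012, I Ex 3.2 (v) p.72] -/
theorem sum_inr_faithful : (Sum.inr_ C C').Faithful :=
  ⟨fun {_ _} _ _ h => congrArg ULift.down h⟩

end SumFaithful

/-! ### §1. The MODEL tempered side over ANY bad-place group datum -/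

namespace TemperedThetaInput

variable {p : ℕ} [Fact p.Prime] (d : GaloisValDatum.{0} p) {P : Type} [Group P] [TopologicalSpace P]
  (T : BadLocalGroupDatum d.Gal P) {qroot : intNonzero d.k} (hq : ¬ IsUnit qroot)

/-- **The MODEL carrier `ℱ̲_v = ℱ÷_v := 𝒟_v ⊕ (𝒞⊢_v ⊕ 𝒞^Θ_v)`** (disjoint union of the base, the REAL `𝒞⊢_v` and the REAL `𝒞^Θ_v`;
LABEL «[m1 MODEL]»). [cite: Mochizuki2012, I Ex 3.2 (i) p.70] -/
abbrev SumCarrier : Type := T.Dv ⊕ (d.Cdash hq ⊕ T.CTheta d hq)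

/-- **The MODEL structure functor `ℱ̲_v → 𝒟_v`**: the identity on the `𝒟_v`-summand, `𝒞⊢_v → 𝒟⊢_v ⊆ 𝒟_v` on the second,
`𝒞^Θ_v → 𝒟^Θ_v ⊆ (𝒟_v)_{Ÿ_v} → 𝒟_v` on the third. [cite: Mochizuki2012, I Ex 3.2 (i) p.70] -/
def sumToBase : SumCarrier d T hq ⥤ T.Dv :=
  (𝟭 T.Dv).sum' ((d.CdashBase hq ⋙ T.incl).sum' (T.CThetaBase d hq ⋙ T.dThetaIncl ⋙ Over.forget T.ydd))

/-- **The MODEL hull `𝒞_v := 𝒞⊢_v ⊆ ℱ̲_v`**: the inclusion of the second summand. [cite: Mochizuki2012, I Ex 3.2 (iii) p.71] -/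
def sumHull : d.Cdash hq ⥤ SumCarrier d T hq :=
  Sum.inl_ (d.Cdash hq) (T.CTheta d hq) ⋙ Sum.inr_ T.Dv (d.Cdash hq ⊕ T.CTheta d hq)

/-- **The MODEL `𝒞^Θ_v ⊆ ℱ÷_v`**: the inclusion of the third summand. [cite: Mochizuki2012, I Ex 3.2 (v) p.72] -/
def sumCTheta : T.CTheta d hq ⥤ SumCarrier d T hq :=
  Sum.inr_ (d.Cdash hq) (T.CTheta d hq) ⋙ Sum.inr_ T.Dv (d.Cdash hq ⊕ T.CTheta d hq)

/-- The hull is faithful. [cite: Mochizuki2012, I Ex 3.2 (iii) p.71] -/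
theorem sumHull_faithful : (sumHull d T hq).Faithful :=
  haveI := sum_inl_faithful (d.Cdash hq) (T.CTheta d hq)
  haveI := sum_inr_faithful T.Dv (d.Cdash hq ⊕ T.CTheta d hq)
  Functor.Faithful.comp _ _

/-- `𝒞^Θ_v ⊆ ℱ÷_v` is faithful. [cite: Mochizuki2012, I Ex 3.2 (v) p.72] -/
theorem sumCTheta_faithful : (sumCTheta d T hq).Faithful :=
  haveI := sum_inr_faithful (d.Cdash hq) (T.CTheta d hq)
  haveI := sum_inr_faithful T.Dv (d.Cdash hq ⊕ T.CTheta d hq)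
  Functor.Faithful.comp _ _

/-- The hull lies over `𝒞⊢_v → 𝒟⊢_v ⊆ 𝒟_v`. [cite: Mochizuki2012, I Ex 3.2 (iv) p.71] -/
def sumHullBaseIso : sumHull d T hq ⋙ sumToBase d T hq ≅ d.CdashBase hq ⋙ T.incl :=
  Functor.associator _ _ _ ≪≫ Functor.isoWhiskerLeft _ (Functor.inrCompSum' _ _) ≪≫ Functor.inlCompSum' _ _

/-- `𝒞^Θ_v ⊆ ℱ÷_v` lies over `𝒞^Θ_v → 𝒟^Θ_v ⊆ (𝒟_v)_{Ÿ_v} → 𝒟_v`. [cite: Mochizuki2012, I Ex 3.2 (v) p.72] -/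
def sumCThetaBaseIso :
    sumCTheta d T hq ⋙ sumToBase d T hq ≅ T.CThetaBase d hq ⋙ T.dThetaIncl ⋙ Over.forget T.ydd :=
  Functor.associator _ _ _ ≪≫ Functor.isoWhiskerLeft _ (Functor.inrCompSum' _ _) ≪≫ Functor.inrCompSum' _ _

/-- **THE MODEL TEMPERED SIDE OVER ANY GROUP DATUM** — an inhabitant of abc-iut-L5-t2's INPUT interface `TemperedThetaInput d T hq`
for EVERY `T : BadLocalGroupDatum d.Gal P` and every non-unit `q̲ ∈ 𝒪^▷_{K_v}`: carriers `𝒟_v ⊕ (𝒞⊢_v ⊕ 𝒞^Θ_v)`, `Tobj := inl` (total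
over `𝒟_v`), `birat := 𝟭`, `𝒞_v := 𝒞⊢_v`, `Θ̲_v := 1`, `𝒪^×(T^÷_Ÿ) := ⊥`, `l·ℤ := ⊥`, constants trivial.  LABEL «[m1 MODEL: formal
disjoint-union tempered side; NOT [EtTh] §5; no Ex 3.2 (i) token]». [cite: Mochizuki2012, I Ex 3.2 (i) p.70] -/
def sumModel : TemperedThetaInput d T hq (SumCarrier d T hq) (SumCarrier d T hq) (d.Cdash hq) where
  toBase := sumToBase d T hq
  Tobj := Sum.inl
  Tobj_base A := Iso.refl A
  birat := 𝟭 _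
  biratBase := sumToBase d T hq
  birat_base := ⟨(sumToBase d T hq).leftUnitor⟩
  unitsTY := ⊥
  unitsTY_comm x hx y hy := by
    rw [Subgroup.mem_bot] at hx hy
    rw [hx, hy]
  theta := 1
  theta_mem := Subgroup.one_mem _
  lZ := ⊥
  constUnits := 1
  hull := sumHull d T hq
  hull_faithful := sumHull_faithful d T hq
  CdashToC := 𝟭 _
  CdashToC_faithful := inferInstance
  CdashToC_base := ⟨(sumHull d T hq ⋙ sumToBase d T hq).leftUnitor ≪≫ sumHullBaseIso d T hq⟩
  CThetaToBirat := sumCTheta d T hq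
  CThetaToBirat_faithful := sumCTheta_faithful d T hq
  CThetaToBirat_base := ⟨sumCThetaBaseIso d T hq⟩

/-- The model's Frobenius-trivial object over `A` is the point `inl A` of the `𝒟_v`-summand. [cite: Mochizuki2012, I Ex 3.2 (i) p.70] -/
theorem sumModel_Tobj (A : T.Dv) : (sumModel d T hq).Tobj A = Sum.inl A := rfl

/-- … and lies over `A` ON THE NOSE. [cite: Mochizuki2012, I Ex 3.2 (i) p.70] -/
theorem sumModel_toBase_obj_Tobj (A : T.Dv) : (sumModel d T hq).toBase.obj ((sumModel d T hq).Tobj A) = A := rfl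

/-- HONESTY: the model's `Θ̲_v` is the identity. [cite: Mochizuki2012, I Ex 3.2 (ii) p.70] -/
theorem sumModel_theta : (sumModel d T hq).theta = 1 := rfl

/-- HONESTY: the model's `𝒪^×(T^÷_{Ÿ_v})` is trivial. [cite: Mochizuki2012, I Ex 3.2 (ii) p.70] -/
theorem sumModel_unitsTY : (sumModel d T hq).unitsTY = ⊥ := rfl

/-- HONESTY: the model's `l·ℤ` is trivial. [cite: Mochizuki2012, I Ex 3.2 (ii) p.71] -/
theorem sumModel_lZ : (sumModel d T hq).lZ = ⊥ := rfl

/-- HONESTY: the model's hull `𝒞_v` IS `𝒞⊢_v` (`CdashToC = 𝟭`). [cite: Mochizuki2012, I Ex 3.2 (iv) p.71] -/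
theorem sumModel_CdashToC : (sumModel d T hq).CdashToC = 𝟭 _ := rfl

/-- **The INPUT interface of Ex. 3.2 is inhabited over every group datum and every non-unit `q̲`** (by the model).
[cite: Mochizuki2012, I Ex 3.2 (i) p.70] -/
theorem nonempty_sumCarrier :
    Nonempty (TemperedThetaInput d T hq (SumCarrier d T hq) (SumCarrier d T hq) (d.Cdash hq)) :=
  ⟨sumModel d T hq⟩

end TemperedThetaInput

/-! ### §2. The (m1) slot `BadTemperedSide B x hx T` of the merge record is inhabited for every `B`, `x`, `T` -/

namespace InitialThetaData

variable {F K Fbar : Type} [Field F] [NumberField F] [Field K] [NumberField K] [Algebra F K]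
  [Field Fbar] [Algebra F Fbar] [Algebra K Fbar] {E : WeierstrassCurve F}
  [E.IsElliptic] {l : ℕ} {Pb : BadPlacePredicates K} (D : InitialThetaData F K Fbar E l Pb)
  (B : ∀ v, v ∈ D.indexCopyBad → D.BadPairAt v)

/-- **THE MODEL (m1) SLOT at a bad index `x` over ANY group datum `T` on the pair's `Π_{X̳̲_v̲}`**: the sum model of §1 at the
Galois-valuation datum `gvdAt x` and the GENUINE non-unit `q̲_v̲ = qRootAtIdx x` (LABEL «[m1 MODEL …]»).
([IUTchI] Ex 3.2 (i) p.70) [claim: Mochizuki2012, status: disputed] -/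
def badTemperedSideModel (x : D.IndexCopy) (hx : x ∈ D.indexCopyBad)
    (T : BadLocalGroupDatum (D.GalAt x (D.not_mem_arc_of_mem_bad hx)) ↥(B x hx).H) : D.BadTemperedSide B x hx T :=
  haveI : Fact (D.primeAt x (D.not_mem_arc_of_mem_bad hx)).Prime := D.fact_primeAt_prime x _
  { Fv := TemperedThetaInput.SumCarrier (D.gvdAt x _) T (D.qRootAtIdx_not_isUnit x hx)
    Fbirat := TemperedThetaInput.SumCarrier (D.gvdAt x _) T (D.qRootAtIdx_not_isUnit x hx)
    Cv := (D.gvdAt x (D.not_mem_arc_of_mem_bad hx)).Cdash (D.qRootAtIdx_not_isUnit x hx)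
    Kt := TemperedThetaInput.sumModel (D.gvdAt x _) T (D.qRootAtIdx_not_isUnit x hx) }

/-- The model slot's tempered-side input IS the sum model. ([IUTchI] Ex 3.2 (i) p.70) [claim: Mochizuki2012, status: disputed] -/
theorem badTemperedSideModel_Kt (x : D.IndexCopy) (hx : x ∈ D.indexCopyBad)
    (T : BadLocalGroupDatum (D.GalAt x (D.not_mem_arc_of_mem_bad hx)) ↥(B x hx).H) :
    (D.badTemperedSideModel B x hx T).Kt =
      @TemperedThetaInput.sumModel _ (D.fact_primeAt_prime x (D.not_mem_arc_of_mem_bad hx)) (D.gvdAt x _) _ _ _ T _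
        (D.qRootAtIdx_not_isUnit x hx) := rfl

/-- **The (m1) slot is inhabited for every `B`, every bad index and every group datum.**
([IUTchI] Ex 3.2 (i) p.70) [claim: Mochizuki2012, status: disputed] -/
theorem nonempty_badTemperedSide (x : D.IndexCopy) (hx : x ∈ D.indexCopyBad)
    (T : BadLocalGroupDatum (D.GalAt x (D.not_mem_arc_of_mem_bad hx)) ↥(B x hx).H) : Nonempty (D.BadTemperedSide B x hx T) :=
  ⟨D.badTemperedSideModel B x hx T⟩

/-! ### §3. The knit: `MergeInputs` from the group data alone -/

/-- **`MergeInputs` FROM THE GROUP DATA ALONE**: given (m2) at every bad index, any (m4) and FACT F-0240, the merge record with the MODEL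
(m1) slots of §2 (LABEL «[m1 MODEL …]» — its `frobeniusBadAt` is a MODEL bad local Frobenioid over the GENUINE bases and the GENUINE
`𝒞⊢_v̲ ⥲ 𝒞^Θ_v̲`, `q_v̲`, `q̲_v̲`). ([IUTchI] Def 5.2 (i) p.134) [claim: Mochizuki2012, status: disputed] -/
def MergeInputs.ofGroupData
    (m2 : ∀ x (hx : x ∈ D.indexCopyBad), BadLocalGroupDatum (D.GalAt x (D.not_mem_arc_of_mem_bad hx)) ↥(B x hx).H)
    (m4 : RealifiedGlobalSide) (hTFG : D.geom.extF.GeomTFG) : D.MergeInputs B where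
  m2 := m2
  m1 x hx := D.badTemperedSideModel B x hx (m2 x hx)
  m4 := m4
  geomTFG := hTFG

/-- Its (m2) slots are the given ones. ([IUTchI] Ex 3.2 (i) p.70) [claim: Mochizuki2012, status: disputed] -/
theorem MergeInputs.ofGroupData_m2
    (m2 : ∀ x (hx : x ∈ D.indexCopyBad), BadLocalGroupDatum (D.GalAt x (D.not_mem_arc_of_mem_bad hx)) ↥(B x hx).H)
    (m4 : RealifiedGlobalSide) (hTFG : D.geom.extF.GeomTFG) : (MergeInputs.ofGroupData D B m2 m4 hTFG).m2 = m2 := rfl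

/-- Its (m1) slots are the MODEL slots of §2. ([IUTchI] Ex 3.2 (i) p.70) [claim: Mochizuki2012, status: disputed] -/
theorem MergeInputs.ofGroupData_m1
    (m2 : ∀ x (hx : x ∈ D.indexCopyBad), BadLocalGroupDatum (D.GalAt x (D.not_mem_arc_of_mem_bad hx)) ↥(B x hx).H)
    (m4 : RealifiedGlobalSide) (hTFG : D.geom.extF.GeomTFG) (x : D.IndexCopy) (hx : x ∈ D.indexCopyBad) :
    (MergeInputs.ofGroupData D B m2 m4 hTFG).m1 x hx = D.badTemperedSideModel B x hx (m2 x hx) := rfl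

/-- Its (m4) slot is the given one. ([IUTchI] Def 5.2 (iv) p.134) [claim: Mochizuki2012, status: disputed] -/
theorem MergeInputs.ofGroupData_m4
    (m2 : ∀ x (hx : x ∈ D.indexCopyBad), BadLocalGroupDatum (D.GalAt x (D.not_mem_arc_of_mem_bad hx)) ↥(B x hx).H)
    (m4 : RealifiedGlobalSide) (hTFG : D.geom.extF.GeomTFG) : (MergeInputs.ofGroupData D B m2 m4 hTFG).m4 = m4 := rfl

/-- **`MergeInputs` at `𝒞⊩_mod`**: the knit with abc-iut-L5-t2's GENUINE (m4) `realifiedGlobalSideOfModuli` (p497530) — binders (m2) and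
FACT F-0240 only. ([IUTchI] Def 5.2 (iv) p.134) [claim: Mochizuki2012, status: disputed] -/
def MergeInputs.ofGroupDataModuli
    (m2 : ∀ x (hx : x ∈ D.indexCopyBad), BadLocalGroupDatum (D.GalAt x (D.not_mem_arc_of_mem_bad hx)) ↥(B x hx).H)
    (hTFG : D.geom.extF.GeomTFG) : D.MergeInputs B :=
  MergeInputs.ofGroupData D B m2 D.realifiedGlobalSideOfModuli hTFG

/-- Its (m4) slot is `𝒞⊩_mod`. ([IUTchI] Ex 3.5 (i) p.84) [claim: Mochizuki2012, status: disputed] -/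
theorem MergeInputs.ofGroupDataModuli_m4
    (m2 : ∀ x (hx : x ∈ D.indexCopyBad), BadLocalGroupDatum (D.GalAt x (D.not_mem_arc_of_mem_bad hx)) ↥(B x hx).H)
    (hTFG : D.geom.extF.GeomTFG) : (MergeInputs.ofGroupDataModuli D B m2 hTFG).m4 = D.realifiedGlobalSideOfModuli := rfl

/-- **R59 REDUCED TO (m2) + F-0240**: the merge record over a bad-pair datum `B` is inhabited iff the Ex. 3.2 group datum
`Π_v̲ ↠ G_v̲ ⊇ Π_Ÿ` is inhabited on the pair's own `Π_{X̳̲_v̲}` at every bad index and FACT F-0240 `GeomTFG` holds ((m1) by the MODEL of §2,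
(m4) by `𝒞⊩_mod`). ([IUTchI] Def 5.2 (i) p.134) [claim: Mochizuki2012, status: disputed] -/
theorem nonempty_mergeInputs_iff : Nonempty (D.MergeInputs B) ↔
    (∀ x (hx : x ∈ D.indexCopyBad), Nonempty (BadLocalGroupDatum (D.GalAt x (D.not_mem_arc_of_mem_bad hx)) ↥(B x hx).H)) ∧
      D.geom.extF.GeomTFG := by
  constructor
  · rintro ⟨I⟩
    exact ⟨fun x hx => ⟨I.m2 x hx⟩, I.geomTFG⟩
  · rintro ⟨h, hTFG⟩
    exact ⟨MergeInputs.ofGroupDataModuli D B (fun x hx => (h x hx).some) hTFG⟩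

/-- One direction, by name: (m2) everywhere + F-0240 ⇒ the merge record is inhabited. ([IUTchI] Def 5.2 (i) p.134) [claim: Mochizuki2012, status: disputed] -/
theorem nonempty_mergeInputs_of_groupData
    (m2 : ∀ x (hx : x ∈ D.indexCopyBad), BadLocalGroupDatum (D.GalAt x (D.not_mem_arc_of_mem_bad hx)) ↥(B x hx).H)
    (hTFG : D.geom.extF.GeomTFG) : Nonempty (D.MergeInputs B) :=
  ⟨MergeInputs.ofGroupDataModuli D B m2 hTFG⟩

/-- With NO bad index in the copy of `V̲` (vacuous (m2)), the merge record is inhabited iff F-0240 holds.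
([IUTchI] Def 5.2 (i) p.134) [claim: Mochizuki2012, status: disputed] -/
theorem nonempty_mergeInputs_iff_of_indexCopyBad_eq_empty (hbad : D.indexCopyBad = ∅) :
    Nonempty (D.MergeInputs B) ↔ D.geom.extF.GeomTFG := by
  rw [D.nonempty_mergeInputs_iff B]
  constructor
  · exact fun h => h.2
  · intro hTFG
    refine ⟨fun x hx => ?_, hTFG⟩
    rw [hbad] at hx
    exact absurd hx (Finset.notMem_empty x)

end InitialThetaData

end Literature.IUT.HodgeTheaters

end
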